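import Summits.AtomisticToContinuum.BoseEinsteinCondensation.Theorems.BoxCountShadowRingShare
import HarnessLib

/-!
# BoxCountShadowTruncation — continuation of BoxCountShadowRingShare: the truncated density door (§11)

Continuation of `BoxCountShadowRingShare` (same namespace; v7 of the CountShadow line).  The ring-share door of
§10 only ever uses the TRUNCATED square: in the pointwise Markov/Chebyshev split
`a ≤ (2N'/λ)·a + 4(N'/λ − 1)²·b` (`le_markov_add_chebyshev`) the Chebyshev branch is entered only when
`N' ≤ λ/2`, where `(N'/λ − 1)² ∈ [1/4, 1]`, so the square may be replaced by `min((N'/λ − 1)², 1)` — this is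
the ONE inequality where truncation enters (`le_markov_add_chebyshev_trunc`); everything downstream is monotone.
Hence the door input weakens from the count variance `Σ_B K⁻³ E(N_B/λ − 1)²` (DL_h) to the truncated count
variance `countVarianceTrunc = Σ_B K⁻³ E min((N_B/λ − 1)², 1)` (DLT_h), which is what an energy argument
delivers: a cell with `N_B ≫ λ` costs energy only linearly in `N_B` (superadditivity (2.53), not convexity,
[LSSY2005, after (2.53)]), so the energy controls `min((N_B/λ − 1)², 1)` and not `(N_B/λ − 1)²`.

Contents: `countVarianceTrunc`, `countVarianceTrunc_le_countVariance`, `le_markov_add_chebyshev_trunc`,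
`ringShareDefect_le_trunc` (`pairWeightOn {Q_{B→nb B}(j) < θ K⁻³ P̄_B(j)} ≤ 2θ + 8·countVarianceTrunc + K⁻³`),
the input `GroundStateHorizonDensityLLNTrunc` (DLT_h), `densityLLNTrunc_of_densityLLN : DL_h → DLT_h`, the
door `horizonRingShare_of_densityLLNTrunc : DLT_h → RSH_h` (`θ = 1/40`, `s = 1/80`, `K ≥ 3`) and the kernel
`bec_of_displacement₂ : UGS → LOC_h → DLT_h → DISP_h → CSUF_h → SUF_h → BoseEinsteinCondensation`.
No instances, no notation, no sorry.
-/

open MeasureTheory Filter Set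
open scoped ENNReal NNReal BigOperators

namespace Summit.AtomisticToContinuum.BoseEinsteinCondensation.Theorems.BoxCountShadow

open Literature.MathematicalPhysics.QuantumManyBody.BoseGas
open Summit.AtomisticToContinuum.BoseEinsteinCondensation.Theorems.BoxLatticeFSum
open Summit.AtomisticToContinuum.BoseEinsteinCondensation.Theorems.BoxLabelAffinity
open Summit.AtomisticToContinuum.BoseEinsteinCondensation.Theorems.BoxHorizonAffinity

variable {n : ℕ}

/-! ### §11  The truncated count variance and the truncated door -/

/-- **Truncated count variance at the block scale** `Σ_B K⁻³ ∫ min((N_B(X)/λ − 1)², 1) Φ(X)² dX`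
(`λ = N/K³`): the mean truncated-square relative fluctuation of the FULL cell counts.  Always `≤ ‖Φ‖₂²`;
`≤ countVariance`. [folklore] -/
noncomputable def countVarianceTrunc (L : ℝ) (K : ℕ) (Φ : Config (n + 1) → ℝ) : ℝ≥0∞ :=
  ∑ B : SubIdx K, blockWeight K ^ 2 *
    ∫⁻ X : Config (n + 1), ENNReal.ofReal (min ((((countVec (L / (K : ℝ)) K X B : ℕ) : ℝ) /
      (((n + 1 : ℕ) : ℝ) / (K : ℝ) ^ 3) - 1) ^ 2) 1) * ENNReal.ofReal (Φ X) ^ 2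

/-- `countVarianceTrunc ≤ countVariance` (`min(t, 1) ≤ t`). [folklore] -/
theorem countVarianceTrunc_le_countVariance (L : ℝ) (K : ℕ) (Φ : Config (n + 1) → ℝ) :
    countVarianceTrunc L K Φ ≤ countVariance L K Φ := by
  unfold countVarianceTrunc countVariance
  refine Finset.sum_le_sum fun B _ => mul_le_mul' le_rfl (lintegral_mono fun X => ?_)
  exact mul_le_mul' (ENNReal.ofReal_le_ofReal (min_le_left _ _)) le_rfl

/-- Measurability of the truncated variance integrand `min((N_B/λ − 1)², 1) Φ²`. [folklore] -/
theorem measurable_varTermTrunc {ℓ : ℝ} {K : ℕ} (B : SubIdx K) (lam : ℝ) {Φ : Config n → ℝ}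
    (hΦm : Measurable Φ) :
    Measurable fun X : Config n =>
      ENNReal.ofReal (min ((((countVec ℓ K X B : ℕ) : ℝ) / lam - 1) ^ 2) 1) * ENNReal.ofReal (Φ X) ^ 2 :=
  ((measurable_of_countable fun k : ℕ => ENNReal.ofReal (min ((((k : ℕ) : ℝ) / lam - 1) ^ 2) 1)).comp
    ((measurable_pi_apply B).comp (measurable_countVec ℓ K))).mul (hΦm.ennreal_ofReal.pow_const 2)

/-- **Markov + truncated Chebyshev, pointwise** — the ONE inequality where truncation enters: with `λ > 0`,
`a ≤ b`, `a ≤ (2N'/λ)·a + 4·min((N'/λ − 1)², 1)·b` (first term when `N' > λ/2`; when `N' ≤ λ/2` the square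
`(N'/λ − 1)²` lies in `[1/4, 1]`, so its truncation at `1` still dominates `1/4`). [folklore] -/
theorem le_markov_add_chebyshev_trunc {lam : ℝ} (hlam : 0 < lam) (N' : ℕ) {a b : ℝ≥0∞} (hab : a ≤ b) :
    a ≤ ENNReal.ofReal (2 / lam * (N' : ℝ)) * a +
      4 * ENNReal.ofReal (min (((N' : ℝ) / lam - 1) ^ 2) 1) * b := by
  by_cases h : (N' : ℝ) ≤ lam / 2
  · have hq : (1 / 4 : ℝ) ≤ min (((N' : ℝ) / lam - 1) ^ 2) 1 := by
      have h1 : (N' : ℝ) / lam ≤ 1 / 2 := by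
        rw [div_le_iff₀ hlam]; linarith
      have h2 : (1 / 2 : ℝ) ≤ 1 - (N' : ℝ) / lam := by linarith
      have h0 : (0 : ℝ) ≤ 1 / 2 := by norm_num
      refine le_min ?_ (by norm_num)
      calc (1 / 4 : ℝ) = (1 / 2) ^ 2 := by norm_num
        _ ≤ (1 - (N' : ℝ) / lam) ^ 2 := pow_le_pow_left₀ h0 h2 2
        _ = ((N' : ℝ) / lam - 1) ^ 2 := by ring
    have hone : (1 : ℝ≥0∞) ≤ 4 * ENNReal.ofReal (min (((N' : ℝ) / lam - 1) ^ 2) 1) :=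
      calc (1 : ℝ≥0∞) = 4 * ENNReal.ofReal (1 / 4) := by
            rw [ENNReal.ofReal_div_of_pos (by norm_num : (0:ℝ) < 4), ENNReal.ofReal_one,
              ENNReal.ofReal_ofNat, ENNReal.mul_div_cancel (by norm_num) ENNReal.ofNat_ne_top]
        _ ≤ 4 * ENNReal.ofReal (min (((N' : ℝ) / lam - 1) ^ 2) 1) := by
            gcongr
    calc a ≤ b := hab
      _ = 1 * b := (one_mul b).symm
      _ ≤ 4 * ENNReal.ofReal (min (((N' : ℝ) / lam - 1) ^ 2) 1) * b := mul_le_mul' hone le_rfl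
      _ ≤ _ := le_add_self
  · rw [not_le] at h
    have hone : (1 : ℝ≥0∞) ≤ ENNReal.ofReal (2 / lam * (N' : ℝ)) := by
      rw [ENNReal.one_le_ofReal, div_mul_eq_mul_div, le_div_iff₀ hlam]
      linarith
    calc a = 1 * a := (one_mul a).symm
      _ ≤ ENNReal.ofReal (2 / lam * (N' : ℝ)) * a := mul_le_mul' hone le_rfl
      _ ≤ _ := le_self_add

/-- **The ring-share defect bound, truncated form.** For a Bose-symmetric normalised amplitude and `K ≥ 2`,
the pairs `(B, j)` at which the designated neighbour `nb B` receives the tagged particle at rate `< θ·K⁻³P̄_B(j)`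
on the fibre `m_B = j` have total weight `≤ 2θ + 8·countVarianceTrunc + K⁻³` — the proof of `ringShareDefect_le`
verbatim with `le_markov_add_chebyshev_trunc` in place of `le_markov_add_chebyshev`. [folklore] -/
theorem ringShareDefect_le_trunc {L : ℝ} {K : ℕ} (hL : 0 < L) (hK2 : 2 ≤ K) {Φ : Config (n + 1) → ℝ}
    (hΦm : Measurable Φ) (hsym : ∀ (σ : Equiv.Perm (Fin (n + 1))) (X : Config (n + 1)), Φ (X ∘ σ) = Φ X)
    (hΦ1 : ∫⁻ Y : Config n, ∫⁻ x, ENNReal.ofReal (Φ (Matrix.vecCons x Y)) ^ 2 = 1) (θ : ℝ≥0∞) :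
    pairWeightOn L K Φ {p | cellPairMass L K Φ p.1 (nb p.1) p.2 < θ * pairWeight L K Φ p} ≤
      2 * θ + 8 * countVarianceTrunc L K Φ + blockWeight K ^ 2 := by
  have hK : 0 < K := lt_of_lt_of_le two_pos hK2
  have hKr : (0 : ℝ) < K := by exact_mod_cast hK
  have hNr : (0 : ℝ) < ((n + 1 : ℕ) : ℝ) := by positivity
  set lam : ℝ := ((n + 1 : ℕ) : ℝ) / (K : ℝ) ^ 3 with hlamdef
  have hlam : 0 < lam := by positivity
  set D : Set (SubIdx K × ℕ) := {p | cellPairMass L K Φ p.1 (nb p.1) p.2 < θ * pairWeight L K Φ p}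
    with hDdef
  set Dc : SubIdx K → Set ℕ := fun B => {j | (B, j) ∈ D} with hDcdef
  set S : SubIdx K → Set (Config (n + 1)) := fun B => {X | countVec (L / (K : ℝ)) K X B ∈ Dc B} with hSdef
  have hS : ∀ B, MeasurableSet (S B) := fun B => measurableSet_countVec_mem (L / (K : ℝ)) K B (Dc B)
  have hΦ2 : Measurable fun X => ENNReal.ofReal (Φ X) ^ 2 := hΦm.ennreal_ofReal.pow_const 2
  have hT : ∀ B, Measurable ((fun m : SubIdx K → ℕ => m B) ∘ countVec (n := n) (L / (K : ℝ)) K) := fun B =>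
    (measurable_pi_apply B).comp (measurable_countVec (L / (K : ℝ)) K)
  have hNm : ∀ B, Measurable fun X : Config (n + 1) => ((countVec (L / (K : ℝ)) K X B : ℕ) : ℝ≥0∞) := fun B =>
    measurable_natCast_ennreal_countVec B
  -- the truncated variance terms
  set V : SubIdx K → ℝ≥0∞ := fun B => ∫⁻ X : Config (n + 1),
    ENNReal.ofReal (min ((((countVec (L / (K : ℝ)) K X B : ℕ) : ℝ) / lam - 1) ^ 2) 1) *
      ENNReal.ofReal (Φ X) ^ 2 with hVdef
  have hCV : countVarianceTrunc L K Φ = ∑ B, blockWeight K ^ 2 * V B := rfl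
  -- Step 1: the defect weight, cell by cell, as tagged fibre integrals
  have h1 : pairWeightOn L K Φ D = ∑ B, blockWeight K ^ 2 *
      ∫⁻ Y in ((fun m : SubIdx K → ℕ => m B) ∘ countVec (L / (K : ℝ)) K) ⁻¹' (Dc B), sliceSq Φ Y := by
    unfold pairWeightOn
    refine Finset.sum_congr rfl fun B _ => ?_
    rw [← tsum_indicator_fibre volume (hT B) (sliceSq Φ) (Dc B), ← ENNReal.tsum_mul_left]
    refine tsum_congr fun j => ?_
    by_cases hj : (B, j) ∈ D
    · have hj' : j ∈ Dc B := hj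
      rw [Set.indicator_of_mem hj, Set.indicator_of_mem hj']
      rfl
    · have hj' : j ∉ Dc B := hj
      rw [Set.indicator_of_notMem hj, Set.indicator_of_notMem hj', mul_zero]
  -- Step 2: on the defect set the designated neighbour's size-biased mass is small
  have h2 : ∀ B, ∫⁻ X, ((countVec (L / (K : ℝ)) K X (nb B) : ℕ) : ℝ≥0∞) *
      (S B).indicator (fun X => ENNReal.ofReal (Φ X) ^ 2) X ≤
        ((n + 1 : ℕ) : ℝ≥0∞) * (θ * blockWeight K ^ 2) := by
    intro B
    have hne : nb B ≠ B := (nb_mem_nbrs hK2 B).1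
    rw [← exchange_cellPairMass hL hK hΦm hsym hne (Dc B),
      ← tsum_indicator_fibre volume (hT B) (blockMass L K Φ (nb B)) (Dc B)]
    gcongr
    have hS1 : ∑' j : ℕ, cellSlice L K Φ B j = 1 := by
      unfold cellSlice
      rw [← lintegral_eq_tsum_fibre volume (hT B) (sliceSq Φ)]
      exact hΦ1
    calc ∑' j, (Dc B).indicator (fun j => ∫⁻ Y in ((fun m : SubIdx K → ℕ => m B) ∘
              countVec (L / (K : ℝ)) K) ⁻¹' {j}, blockMass L K Φ (nb B) Y) j
        ≤ ∑' j, θ * blockWeight K ^ 2 * cellSlice L K Φ B j := by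
          refine ENNReal.tsum_le_tsum fun j => ?_
          by_cases hj : j ∈ Dc B
          · rw [Set.indicator_of_mem hj]
            have hlt : cellPairMass L K Φ B (nb B) j < θ * pairWeight L K Φ (B, j) := hj
            rw [mul_assoc]
            exact hlt.le
          · rw [Set.indicator_of_notMem hj]
            exact bot_le
      _ = θ * blockWeight K ^ 2 := by rw [ENNReal.tsum_mul_left, hS1, mul_one]
  -- the constant: (2/λ) · N · θ · K⁻³ = 2θ
  have hconst : ENNReal.ofReal (2 / lam) * (((n + 1 : ℕ) : ℝ≥0∞) * (θ * blockWeight K ^ 2)) = 2 * θ := by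
    rw [blockWeight_sq hK, ← ENNReal.ofReal_natCast (n + 1)]
    calc ENNReal.ofReal (2 / lam) * (ENNReal.ofReal ((n + 1 : ℕ) : ℝ) * (θ * ENNReal.ofReal (((K : ℝ) ^ 3)⁻¹)))
        = ENNReal.ofReal (2 / lam * ((n + 1 : ℕ) : ℝ) * ((K : ℝ) ^ 3)⁻¹) * θ := by
          rw [ENNReal.ofReal_mul (by positivity), ENNReal.ofReal_mul (by positivity)]; ring
      _ = 2 * θ := by
          have : 2 / lam * ((n + 1 : ℕ) : ℝ) * ((K : ℝ) ^ 3)⁻¹ = 2 := by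
            rw [hlamdef]; field_simp
          rw [this, ENNReal.ofReal_ofNat]
  -- Step 3: Markov + truncated Chebyshev for the full count of the designated neighbour
  have h3 : ∀ B, ∫⁻ X, (S B).indicator (fun X => ENNReal.ofReal (Φ X) ^ 2) X ≤ 2 * θ + 4 * V (nb B) := by
    intro B
    have hmN : Measurable fun X : Config (n + 1) => ((countVec (L / (K : ℝ)) K X (nb B) : ℕ) : ℝ≥0∞) *
        (S B).indicator (fun X => ENNReal.ofReal (Φ X) ^ 2) X := (hNm (nb B)).mul (hΦ2.indicator (hS B))
    have hmA : Measurable fun X : Config (n + 1) => ENNReal.ofReal (2 / lam) *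
        (((countVec (L / (K : ℝ)) K X (nb B) : ℕ) : ℝ≥0∞) *
          (S B).indicator (fun X => ENNReal.ofReal (Φ X) ^ 2) X) := hmN.const_mul _
    have hpt : ∀ X, (S B).indicator (fun X => ENNReal.ofReal (Φ X) ^ 2) X ≤
        ENNReal.ofReal (2 / lam) * (((countVec (L / (K : ℝ)) K X (nb B) : ℕ) : ℝ≥0∞) *
            (S B).indicator (fun X => ENNReal.ofReal (Φ X) ^ 2) X) +
          4 * (ENNReal.ofReal (min ((((countVec (L / (K : ℝ)) K X (nb B) : ℕ) : ℝ) / lam - 1) ^ 2) 1) *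
            ENNReal.ofReal (Φ X) ^ 2) := by
      intro X
      have h := le_markov_add_chebyshev_trunc hlam (countVec (L / (K : ℝ)) K X (nb B))
        (Set.indicator_le_self (S B) (fun X => ENNReal.ofReal (Φ X) ^ 2) X)
      rw [ENNReal.ofReal_mul (by positivity), ENNReal.ofReal_natCast] at h
      simpa only [mul_assoc] using h
    calc ∫⁻ X, (S B).indicator (fun X => ENNReal.ofReal (Φ X) ^ 2) X
        ≤ ∫⁻ X, (ENNReal.ofReal (2 / lam) * (((countVec (L / (K : ℝ)) K X (nb B) : ℕ) : ℝ≥0∞) *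
            (S B).indicator (fun X => ENNReal.ofReal (Φ X) ^ 2) X) +
          4 * (ENNReal.ofReal (min ((((countVec (L / (K : ℝ)) K X (nb B) : ℕ) : ℝ) / lam - 1) ^ 2) 1) *
            ENNReal.ofReal (Φ X) ^ 2)) := lintegral_mono hpt
      _ = ENNReal.ofReal (2 / lam) * (∫⁻ X, ((countVec (L / (K : ℝ)) K X (nb B) : ℕ) : ℝ≥0∞) *
            (S B).indicator (fun X => ENNReal.ofReal (Φ X) ^ 2) X) + 4 * V (nb B) := by
          rw [lintegral_add_left hmA, lintegral_const_mul _ hmN,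
            lintegral_const_mul _ (measurable_varTermTrunc (nb B) lam hΦm)]
      _ ≤ 2 * θ + 4 * V (nb B) := by
          rw [← hconst]
          exact add_le_add (mul_le_mul' le_rfl (h2 B)) le_rfl
  -- Step 4: the tagged correction Σ_B K⁻³ ∫ q_B ≤ K⁻³
  have h4 : ∑ B : SubIdx K, blockWeight K ^ 2 * ∫⁻ Y, blockMass L K Φ B Y ≤ blockWeight K ^ 2 := by
    rw [← Finset.mul_sum, ← lintegral_finsetSum _ fun B _ => measurable_blockMass L K hΦm B]
    calc blockWeight K ^ 2 * ∫⁻ Y, ∑ B, blockMass L K Φ B Y ≤ blockWeight K ^ 2 * ∫⁻ Y, sliceSq Φ Y :=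
          mul_le_mul' le_rfl (lintegral_mono fun Y => sum_blockMass_le_sliceSq hL hK hΦm Y)
      _ = blockWeight K ^ 2 := by
          have : ∫⁻ Y, sliceSq Φ Y = 1 := hΦ1
          rw [this, mul_one]
  -- assemble
  have ha : ∑ B : SubIdx K, blockWeight K ^ 2 * (2 * θ) ≤ 2 * θ := by
    rw [← Finset.sum_mul, sum_blockWeight_sq hK, one_mul]
  have hb : ∑ B : SubIdx K, blockWeight K ^ 2 * (4 * V (nb B)) ≤ 8 * countVarianceTrunc L K Φ :=
    calc ∑ B : SubIdx K, blockWeight K ^ 2 * (4 * V (nb B))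
        = blockWeight K ^ 2 * (4 * ∑ B : SubIdx K, V (nb B)) := by rw [← Finset.mul_sum, ← Finset.mul_sum]
      _ ≤ blockWeight K ^ 2 * (4 * (2 * ∑ B : SubIdx K, V B)) :=
          mul_le_mul' le_rfl (mul_le_mul' le_rfl (sum_nb_le V))
      _ = 8 * (blockWeight K ^ 2 * ∑ B : SubIdx K, V B) := by ring
      _ = 8 * countVarianceTrunc L K Φ := by rw [hCV, Finset.mul_sum]
  have hper : ∀ B : SubIdx K, blockWeight K ^ 2 *
      ∫⁻ Y in ((fun m : SubIdx K → ℕ => m B) ∘ countVec (L / (K : ℝ)) K) ⁻¹' (Dc B), sliceSq Φ Y ≤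
        blockWeight K ^ 2 * (2 * θ) + (blockWeight K ^ 2 * (4 * V (nb B)) +
          blockWeight K ^ 2 * ∫⁻ Y, blockMass L K Φ B Y) := by
    intro B
    rw [← mul_add, ← mul_add]
    refine mul_le_mul' le_rfl ?_
    calc ∫⁻ Y in ((fun m : SubIdx K → ℕ => m B) ∘ countVec (L / (K : ℝ)) K) ⁻¹' (Dc B), sliceSq Φ Y
        ≤ (∫⁻ X, (S B).indicator (fun X => ENNReal.ofReal (Φ X) ^ 2) X) + ∫⁻ Y, blockMass L K Φ B Y :=
          cellSlice_le_full hΦm B (Dc B)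
      _ ≤ (2 * θ + 4 * V (nb B)) + ∫⁻ Y, blockMass L K Φ B Y := add_le_add (h3 B) le_rfl
      _ = 2 * θ + (4 * V (nb B) + ∫⁻ Y, blockMass L K Φ B Y) := add_assoc _ _ _
  rw [h1]
  calc ∑ B, blockWeight K ^ 2 *
          ∫⁻ Y in ((fun m : SubIdx K → ℕ => m B) ∘ countVec (L / (K : ℝ)) K) ⁻¹' (Dc B), sliceSq Φ Y
      ≤ ∑ B, (blockWeight K ^ 2 * (2 * θ) + (blockWeight K ^ 2 * (4 * V (nb B)) +
          blockWeight K ^ 2 * ∫⁻ Y, blockMass L K Φ B Y)) := Finset.sum_le_sum fun B _ => hper B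
    _ = ∑ B, blockWeight K ^ 2 * (2 * θ) + (∑ B, blockWeight K ^ 2 * (4 * V (nb B)) +
          ∑ B, blockWeight K ^ 2 * ∫⁻ Y, blockMass L K Φ B Y) := by
        rw [Finset.sum_add_distrib, Finset.sum_add_distrib]
    _ ≤ 2 * θ + (8 * countVarianceTrunc L K Φ + blockWeight K ^ 2) := add_le_add ha (add_le_add hb h4)
    _ = 2 * θ + 8 * countVarianceTrunc L K Φ + blockWeight K ^ 2 := (add_assoc _ _ _).symm

/-- **DLT_h(η)** (door input · TAG ENERGY-CLASS · TRUE-type · WEAKER than DL_h (`countVarianceTrunc ≤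
countVariance`) and than the conjunct · leaf ATTACKABLE·M, class = COERCIVITY OF THE ENERGY IN THE COARSE DENSITY,
discharged from `GroundStateHorizonCellCoercivity` and the tree's Dyson upper bound in `BoxCountShadowCoercivity`)
`GroundStateHorizonDensityLLNTrunc η`: for `a > 0`, every target `s > 0` and every horizon constant `M > 0`, below a
density cap, eventually in `N`, for every `K` of the horizon window the mean TRUNCATED-square relative fluctuation of
the full horizon-cell counts of the ground state is `≤ s`: `Σ_B K⁻³ E_{Ψ₀²} min((N_B/λ − 1)², 1) ≤ s`, `λ = N/K³`.
Why it might fail: only through a failure of the leading-order energy asymptotics at the horizon scale for the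
Dirichlet minimiser (it is implied by `GroundStateHorizonCellCoercivity η`, an LY-class statement). NOT implied by
LOC_h (half-filled lattice state) nor implying it (number-locked state). [cite: LSSY2005, Thm. 2.4 (2.35), (2.52)–(2.53)] -/
@[conjecture] def GroundStateHorizonDensityLLNTrunc (η : ℝ≥0) : Prop :=
  ∀ v : ℝ → ℝ≥0∞, IsRepulsiveFiniteRange v → 0 < scatteringLength v →
    ∀ s : ℝ, 0 < s → ∀ M : ℝ, 0 < M → ∃ ρ₀ : ℝ, 0 < ρ₀ ∧ ∀ ρ : ℝ, 0 < ρ → ρ < ρ₀ →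
      ∀ᶠ n : ℕ in atTop,
        (∃ Ψ₀ : Config (n + 1) → ℝ, (∀ X, 0 ≤ Ψ₀ X) ∧
          IsGroundState v (sideLength ρ (n + 1)) (fun X => (Ψ₀ X : ℂ))) →
        ∀ K : ℕ, 0 < K → InWindow (M * ρ ^ (-(η : ℝ))) ρ (sideLength ρ (n + 1)) K →
          countVarianceTrunc (sideLength ρ (n + 1)) K (groundState v (n + 1) (sideLength ρ (n + 1))) ≤
            ENNReal.ofReal s

/-- **DL_h ⟹ DLT_h** (`countVarianceTrunc ≤ countVariance`). [folklore] -/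
theorem densityLLNTrunc_of_densityLLN (η : ℝ≥0) (hdl : GroundStateHorizonDensityLLN η) :
    GroundStateHorizonDensityLLNTrunc η := by
  intro v hv ha s hs M hM
  obtain ⟨ρ₀, hρ₀, h⟩ := hdl v hv ha s hs M hM
  refine ⟨ρ₀, hρ₀, fun ρ hρ hρlt => ?_⟩
  filter_upwards [h ρ hρ hρlt] with n hn hex K hK hKw
  exact (countVarianceTrunc_le_countVariance _ _ _).trans (hn hex K hK hKw)

/-- **DLT_h ⟹ RSH_h** (`θ = 1/40`, any `M₀`; from `ringShareDefect_le_trunc` with `s = 1/80` and `K ≥ 3`):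
the truncated density law of large numbers at the horizon scale gives the ring share. [folklore] -/
theorem horizonRingShare_of_densityLLNTrunc (η : ℝ≥0) (hdl : GroundStateHorizonDensityLLNTrunc η) :
    GroundStateHorizonRingShare η := by
  intro v hv ha
  refine ⟨1, one_pos, fun M hM => ?_⟩
  have hMpos : 0 < M := lt_of_lt_of_le one_pos hM
  obtain ⟨ρ₀, hρ₀, h⟩ := hdl v hv ha (1 / 80) (by norm_num) M hMpos
  refine ⟨1 / 40, by norm_num, ρ₀, hρ₀, fun ρ hρ hρlt => ?_⟩
  have hA : 0 < M * ρ ^ (-(η : ℝ)) := mul_pos hMpos (Real.rpow_pos_of_pos hρ _)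
  have hev : ∀ᶠ n : ℕ in atTop, 3 * (2 * (M * ρ ^ (-(η : ℝ))) / Real.sqrt ρ) ≤ sideLength ρ (n + 1) :=
    (tendsto_add_atTop_nat 1).eventually ((tendsto_sideLength_atTop hρ).eventually_ge_atTop _)
  filter_upwards [h ρ hρ hρlt, hev] with n hn hLn hex K hK hKw
  set L := sideLength ρ (n + 1) with hLdef
  have hL : 0 < L := sideLength_pos_of_inWindow hA hρ hK hKw
  have hK3 : 3 ≤ K := three_le_of_inWindow hA hρ hK hKw hLn
  have hK2 : 2 ≤ K := le_trans (by norm_num) hK3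
  set Φ := groundState v (n + 1) L with hΦdef
  have hΦm : Measurable Φ := measurable_groundState v (n + 1) L
  have hsym : ∀ (σ : Equiv.Perm (Fin (n + 1))) (X : Config (n + 1)), Φ (X ∘ σ) = Φ X :=
    fun σ X => groundState_comp_perm v L σ X
  have hΦ1 : ∫⁻ Y : Config n, ∫⁻ x, ENNReal.ofReal (Φ (Matrix.vecCons x Y)) ^ 2 = 1 := by
    rw [← lintegral_eq_lintegral_lintegral_vecCons (hΦm.ennreal_ofReal.pow_const 2)]
    exact lintegral_groundState_sq hex
  have hCV : countVarianceTrunc L K Φ ≤ ENNReal.ofReal (1 / 80) := hn hex K hK hKw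
  set D : Set (SubIdx K × ℕ) :=
    {p | cellPairMass L K Φ p.1 (nb p.1) p.2 < ENNReal.ofReal (1 / 40) * pairWeight L K Φ p} with hDdef
  have hD := ringShareDefect_le_trunc hL hK2 hΦm hsym hΦ1 (ENNReal.ofReal (1 / 40))
  refine ⟨Dᶜ, ?_, ?_⟩
  · rw [compl_compl]
    have e1 : (2 : ℝ≥0∞) * ENNReal.ofReal (1 / 40) = ENNReal.ofReal (1 / 20) := by
      rw [show (1 / 20 : ℝ) = 2 * (1 / 40) by norm_num, ENNReal.ofReal_mul (by norm_num : (0 : ℝ) ≤ 2),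
        ENNReal.ofReal_ofNat]
    have e2 : (8 : ℝ≥0∞) * ENNReal.ofReal (1 / 80) = ENNReal.ofReal (1 / 10) := by
      rw [show (1 / 10 : ℝ) = 8 * (1 / 80) by norm_num, ENNReal.ofReal_mul (by norm_num : (0 : ℝ) ≤ 8),
        ENNReal.ofReal_ofNat]
    have e3 : blockWeight K ^ 2 ≤ ENNReal.ofReal (1 / 27) := by
      rw [blockWeight_sq hK]
      apply ENNReal.ofReal_le_ofReal
      have hK3r : (3 : ℝ) ≤ K := by exact_mod_cast hK3
      have h27 : (27 : ℝ) ≤ (K : ℝ) ^ 3 :=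
        calc (27 : ℝ) = 3 ^ 3 := by norm_num
          _ ≤ (K : ℝ) ^ 3 := pow_le_pow_left₀ (by norm_num) hK3r 3
      rw [one_div]
      exact inv_anti₀ (by norm_num) h27
    have hquarter : (1 / 4 : ℝ≥0∞) = ENNReal.ofReal (1 / 4) := by
      rw [ENNReal.ofReal_div_of_pos (by norm_num : (0 : ℝ) < 4), ENNReal.ofReal_one, ENNReal.ofReal_ofNat]
    calc pairWeightOn L K Φ D
        ≤ 2 * ENNReal.ofReal (1 / 40) + 8 * countVarianceTrunc L K Φ + blockWeight K ^ 2 := hD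
      _ ≤ ENNReal.ofReal (1 / 20) + ENNReal.ofReal (1 / 10) + ENNReal.ofReal (1 / 27) :=
          add_le_add (add_le_add e1.le ((mul_le_mul' le_rfl hCV).trans_eq e2)) e3
      _ = ENNReal.ofReal (1 / 20 + 1 / 10 + 1 / 27) := by
          rw [ENNReal.ofReal_add (by norm_num) (by norm_num), ENNReal.ofReal_add (by norm_num) (by norm_num)]
      _ ≤ 1 / 4 := by
          rw [hquarter]
          exact ENNReal.ofReal_le_ofReal (by norm_num)
  · intro B j hp
    refine ⟨nb B, nb_mem_nbrs hK2 B, ?_⟩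
    have hp' : ¬ (cellPairMass L K Φ B (nb B) j < ENNReal.ofReal (1 / 40) * pairWeight L K Φ (B, j)) := hp
    exact not_lt.1 hp'

/-- The §10 door is the special case of the truncated door (DL_h ⟹ DLT_h ⟹ RSH_h). [folklore] -/
theorem horizonRingShare_of_densityLLN' (η : ℝ≥0) (hdl : GroundStateHorizonDensityLLN η) :
    GroundStateHorizonRingShare η :=
  horizonRingShare_of_densityLLNTrunc η (densityLLNTrunc_of_densityLLN η hdl)

/-- The kernel through the displacement door with the ring share discharged by the TRUNCATED density law of
large numbers: UGS → LOC_h(η) → DLT_h(η) → DISP_h(η) → CSUF_h(η) → SUF_h(η) → `BoseEinsteinCondensation`. [folklore] -/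
theorem bec_of_displacement₂ (η : ℝ≥0) (hU : BoxGroundStateUniqueness)
    (hloc : GroundStateHorizonCondensation η) (hdlt : GroundStateHorizonDensityLLNTrunc η)
    (hdisp : GroundStateHorizonDisplacement η) (hcsuf : GroundStateHorizonCellCountSufficiency η)
    (hsuf : GroundStateHorizonCountSufficiency η) : _root_.BoseEinsteinCondensation :=
  bec_of_displacement₀ η hU hloc hdisp (horizonRingShare_of_densityLLNTrunc η hdlt) hcsuf hsuf

end Summit.AtomisticToContinuum.BoseEinsteinCondensation.Theorems.BoxCountShadow
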